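import Mathlib
import Summits.ValiantsHypothesis.ValiantsHypothesis.Theorems.LiouvilleSarnakAlignedTypeICharactersMod2nBilinearSieveKorobovPostnikov
import Summits.ValiantsHypothesis.ValiantsHypothesis.Theorems.LiouvilleSarnakAlignedTypeICharactersMod2nBilinearSieveShortCharSumsShift
import HarnessLib

/-!
# Route LiouvilleSarnak — support `AlignedTypeI` (stmt-ValiantsHypothesis-21040), line `characters_mod_2n`:
# the Postnikov–Gallagher–Korobov block bound with explicit parameters

Brick (B4b) of `HS` (short character sums mod `q = 2^j`).  Gallagher's averaged shift
(`…ShortCharSumsShift.lean`: `norm_sum_Ioc_le_shift_avg`, `char_shift_odd`, `char_shift_even`) and Korobov's bound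
for the Postnikov sums (`…KorobovPostnikov.lean`: `norm_postnikovSum_le`) give, for a primitive `χ` mod `2^{n+τ}`
and Korobov parameters satisfying the explicit side conditions of `norm_postnikovSum_le`, the BLOCK BOUND

  `‖Σ_{M < m ≤ M+N} χ(m)‖ ≤ N e^{10} exp(−2·10⁻⁶ L/Y²) + 2·2^τ a²`   (every `M`, `N`)

(`norm_charSum_Ioc_le_of_params`).  For even `m` the shifted inner sum vanishes; for odd `m` it is `χ(m)` times a
Postnikov sum with the ODD multiplier `ñ = (m̄ mod 2^{n+τ})` (`inv_val_odd`).

What remains for `HS`: the parameter choice (`Y = log q/log N ≥ 10`, `L = log N ≥ 10⁶Y²`, `r = ⌊5.01Y⌋`, `k = 5r²`,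
`τ = ⌊j/(r+1)⌋ + 2`, `a = ⌊N^{0.39}⌋`, good `m ∈ (⌊2Y⌋, ⌊3.5Y⌋]`; then `2·2^τa² ≤ 8N^{0.98}`) and the cover of all
`N ≤ q` (blocks of length `q^{1/10}`, trivial range).

HONEST FRAMING. Helper theorems only (unconditional); the leaf `AlignedTypeI` is NOT closed here; nothing bears on
`VP ≠ VNP` (NOT proved).
-/

set_option linter.dupNamespace false

noncomputable section

namespace Summit.ValiantsHypothesis.ValiantsHypothesis.Theorems.LiouvilleSarnak.AlignedTypeI.CharactersModTwoN

open Finset Real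
open Literature.NumberTheory.LFunctions
open Literature.NumberTheory.LFunctions.VKZeta (thetaStar)

/-! ### The inverse of an odd residue is odd -/

/-- For odd `m` and `j ≥ 1`, the canonical representative of `m̄ = m⁻¹ (mod 2^j)` is odd. [folklore] -/
theorem inv_val_odd {j : ℕ} (hj : 1 ≤ j) {m : ℕ} (hm : Odd m) :
    Odd ((m : ZMod (2 ^ j))⁻¹).val := by
  haveI : NeZero (2 ^ j) := ⟨pow_ne_zero _ two_ne_zero⟩
  have hu : IsUnit ((m : ℕ) : ZMod (2 ^ j)) := by
    rw [ZMod.isUnit_iff_coprime]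
    exact Nat.Coprime.pow_right _ hm.coprime_two_right
  set w : ZMod (2 ^ j) := (m : ZMod (2 ^ j))⁻¹ with hw
  have hmul : (w.val : ZMod (2 ^ j)) * (m : ZMod (2 ^ j)) = 1 := by
    rw [ZMod.natCast_zmod_val, hw, mul_comm, ZMod.mul_inv_of_unit _ hu]
  have hwu : IsUnit ((w.val : ℕ) : ZMod (2 ^ j)) := isUnit_iff_exists_inv.2 ⟨_, hmul⟩
  rw [ZMod.isUnit_iff_coprime] at hwu
  rw [Nat.odd_iff]
  by_contra h0
  have h2w : 2 ∣ w.val := Nat.dvd_of_mod_eq_zero (by omega)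
  have h2q : 2 ∣ 2 ^ j := dvd_pow_self 2 (by omega)
  have h := Nat.dvd_gcd h2w h2q
  rw [hwu.gcd_eq_one] at h
  omega

/-! ### The block bound -/

/-- ★ **The Postnikov–Gallagher–Korobov block bound with explicit parameters**: for a primitive `χ` mod `2^{n+τ}`
(`n ≥ 1`, `τ ≥ 2`) and Korobov parameters as in `norm_postnikovSum_le`, for every `M, N`:
`‖Σ_{M<m≤M+N} χ(m)‖ ≤ N e^{10} exp(−2·10⁻⁶ L/Y²) + 2·2^τ a²`.
[cite: Ivic1985, Theorem 6.2] [cite: IwaniecKowalski2004, §12.3 (Postnikov–Gallagher)] -/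
theorem norm_charSum_Ioc_le_of_params {τ : ℕ} (hτ : 2 ≤ τ) {n : ℕ} (hn : 1 ≤ n)
    (χ : DirichletCharacter ℂ (2 ^ (n + τ))) (hχ : χ.IsPrimitive)
    {L Y : ℝ} {r k a M₂ M₃ : ℕ} (hY : 10 ≤ Y) (hL : (10 : ℝ) ^ 6 * Y ^ 2 ≤ L)
    (hr1 : 4.91 * Y ≤ r) (hr2 : (r : ℝ) ≤ 5.01 * Y) (hr50 : 50 ≤ r) (hk : k = 5 * r ^ 2)
    (ha1 : 1 ≤ a) (hahi : (a : ℝ) ≤ Real.exp (0.4 * L)) (hrn : r ≤ n + τ) (hM : M₃ ≤ r)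
    (hG1 : 1.5 * Y - 1 ≤ ((M₃ - M₂ : ℕ) : ℝ)) (hG2 : ((M₃ - M₂ : ℕ) : ℝ) ≤ 1.5 * Y + 1)
    (htrunc : ∀ m : ℕ, r < m → m ≤ n + τ → n + τ + padicValNat 2 m ≤ τ * m)
    (hgood : ∀ m : ℕ, M₂ < m → m ≤ M₃ → τ * m < n + τ + padicValNat 2 m ∧
      (2 : ℝ) ^ (n + τ + padicValNat 2 m - τ * m) ≤ (k : ℝ) * (a : ℝ) ^ m ∧
      (4 + Real.log (2 ^ (n + τ + padicValNat 2 m - τ * m))) / 2 ^ (n + τ + padicValNat 2 m - τ * m) ≤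
        thetaStar L Y)
    (M N : ℕ) :
    ‖∑ m ∈ Ioc M (M + N), χ (m : ZMod (2 ^ (n + τ)))‖ ≤
      (N : ℝ) * Real.exp 10 * Real.exp (-(2e-6 * L / Y ^ 2)) + 2 * ((2 ^ τ : ℕ) : ℝ) * (a : ℝ) ^ 2 := by
  have hj : 1 ≤ n + τ := by omega
  have hτ1 : 1 ≤ τ := by omega
  have ha0 : (0 : ℝ) < a := by exact_mod_cast ha1
  set W : ℝ := (a : ℝ) ^ 2 * Real.exp 10 * Real.exp (-(2e-6 * L / Y ^ 2)) with hW
  have hW0 : 0 ≤ W := by positivity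
  -- Gallagher's averaged shift
  have h1 := norm_sum_Ioc_le_shift_avg (f := fun m : ℕ => χ (m : ZMod (2 ^ (n + τ)))) (fun m => χ.norm_le_one _)
    M N (2 ^ τ) a ha1
  -- every inner sum is `≤ W`
  have hinner : ∀ m : ℕ, ‖∑ x ∈ Icc 1 a, ∑ y ∈ Icc 1 a, χ (((m + 2 ^ τ * x * y : ℕ)) : ZMod (2 ^ (n + τ)))‖ ≤ W := by
    intro m
    rcases Nat.even_or_odd m with hm | hm
    · have h0 : ∑ x ∈ Icc 1 a, ∑ y ∈ Icc 1 a, χ ((m + 2 ^ τ * x * y : ℕ) : ZMod (2 ^ (n + τ))) = 0 := by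
        refine sum_eq_zero fun x _ => sum_eq_zero fun y _ => ?_
        rw [mul_assoc]
        exact char_shift_even hj hτ1 χ hm (x * y)
      rw [h0, norm_zero]; exact hW0
    · set nt : ℕ := ((m : ZMod (2 ^ (n + τ)))⁻¹).val with hnt
      have hnt_odd : Odd nt := inv_val_odd hj hm
      haveI : NeZero (2 ^ (n + τ)) := ⟨pow_ne_zero _ two_ne_zero⟩
      have heq : ∑ x ∈ Icc 1 a, ∑ y ∈ Icc 1 a, χ ((m + 2 ^ τ * x * y : ℕ) : ZMod (2 ^ (n + τ))) =
          χ (m : ZMod (2 ^ (n + τ))) * ∑ x ∈ Icc 1 a, ∑ y ∈ Icc 1 a,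
            χ (1 + (2 : ZMod (2 ^ (n + τ))) ^ τ * ((nt : ZMod (2 ^ (n + τ))) * ((x * y : ℕ) : ZMod (2 ^ (n + τ))))) := by
        rw [mul_sum]
        refine sum_congr rfl fun x _ => ?_
        rw [mul_sum]
        refine sum_congr rfl fun y _ => ?_
        rw [mul_assoc, char_shift_odd τ χ hm (x * y), hnt, ZMod.natCast_zmod_val]
      rw [heq, norm_mul]
      have hle : ‖χ (m : ZMod (2 ^ (n + τ)))‖ ≤ 1 := χ.norm_le_one _
      have hP := norm_postnikovSum_le hτ hn χ hχ hY hL hr1 hr2 hr50 hk ha1 hahi hrn hM hG1 hG2 htrunc hgood hnt_odd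
      have h0 : 0 ≤ ‖∑ x ∈ Icc 1 a, ∑ y ∈ Icc 1 a,
          χ (1 + (2 : ZMod (2 ^ (n + τ))) ^ τ * ((nt : ZMod (2 ^ (n + τ))) * ((x * y : ℕ) : ZMod (2 ^ (n + τ)))))‖ :=
        norm_nonneg _
      calc _ ≤ 1 * W := mul_le_mul hle hP h0 zero_le_one
        _ = W := one_mul W
  have hsum : ∑ m ∈ Ioc M (M + N), ‖∑ x ∈ Icc 1 a, ∑ y ∈ Icc 1 a,
      χ (((m + 2 ^ τ * x * y : ℕ)) : ZMod (2 ^ (n + τ)))‖ ≤ (N : ℝ) * W := by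
    refine (sum_le_sum fun m _ => hinner m).trans (le_of_eq ?_)
    rw [sum_const, nsmul_eq_mul, Nat.card_Ioc, Nat.add_sub_cancel_left]
  have ha2 : (0 : ℝ) ≤ 1 / (a : ℝ) ^ 2 := by positivity
  have h3 := mul_le_mul_of_nonneg_left hsum ha2
  have h4 : 1 / (a : ℝ) ^ 2 * ((N : ℝ) * W) = (N : ℝ) * Real.exp 10 * Real.exp (-(2e-6 * L / Y ^ 2)) := by
    rw [hW]; field_simp
  refine h1.trans ?_
  rw [← h4]
  linarith [h3]

end Summit.ValiantsHypothesis.ValiantsHypothesis.Theorems.LiouvilleSarnak.AlignedTypeI.CharactersModTwoN
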